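import Summits.ResolutionOfSingularities.ResolutionOfSingularities.Theorems.PurelyInseparableDim4PthPowerFactor
import HarnessLib
import HarnessLib.Audit.Tags

/-!
# Purely inseparable fourfolds — the CLEANING OF A PRODUCT IN DISJOINT VARIABLES (cell res-dim4-pi; D3b kit, 2)
# [OURS · counted 0 · bookkeeping identities of OUR frame, not about resolution]

Width seat `res-dim4-p-10` (g2).  Sequel of `…PthPowerFactor` (`deletePthPowers_mul_of_forall_dvd`: `q`-th-power factors
are inert under the cleaning).  For the D3b normal forms (`F = ∏ᵢ fᵢ(xᵢ)`, products of univariates) one needs the cleaning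
of a product of polynomials in DISJOINT sets of variables:

* `powPart q P := P − deletePthPowers q P` written out (no definition): its monomials are `q`-th powers
  (`forall_dvd_of_mem_support_sub_deletePthPowers`), and `deletePthPowers` of it is `0`;
* `deletePthPowers_eq_self_of_forall` — a polynomial without `q`-th-power monomials is clean;
* **`deletePthPowers_mul_disjoint`** — if no variable occurs in both `P` and `Q`, then
  `deletePthPowers q (P * Q) = P * Q − (P − deletePthPowers q P) * (Q − deletePthPowers q Q)`:
  the `q`-th-power part of a disjoint product is the product of the `q`-th-power parts («Sq(∏ fᵢ) = ∏ Ev(fᵢ)» of the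
  paper proof `HOME/res-dim4-p-10/D3b-PAPER.md`).

Any commutative ring; nothing here proves resolution of singularities in dimension ≥ 4 / characteristic `p`; counted 0;
AI work, weaker than expert review. bears_on: LADDER-RESOLUTION:D157-DOOR2 (res-dim4-pi · WORD #60 D3b kit). Supports
stmt-ResolutionOfSingularities-16155 (helper).
-/

set_option linter.dupNamespace false

open MvPolynomial Finset

open scoped BigOperators

noncomputable section

namespace Summit.ResolutionOfSingularities.ResolutionOfSingularities.Theorems.PIDim4

namespace PthPowerFactor

open Literature.AlgebraicGeometry.Resolution
open Literature.AlgebraicGeometry.Resolution.Hauser2010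

variable {σ : Type*} [DecidableEq σ] {K : Type*} [CommRing K]

/-! ## 1. The `q`-th-power part `P − deletePthPowers q P` -/

/-- Coefficients of the `q`-th-power part. [folklore] -/
theorem coeff_sub_deletePthPowers (q : ℕ) (P : MvPolynomial σ K) (d : σ →₀ ℕ) :
    coeff d (P - deletePthPowers q P) = if IsPthPowerExponent q d then coeff d P else 0 := by
  rw [coeff_sub, coeff_deletePthPowers]
  split_ifs <;> ring

/-- Every monomial of the `q`-th-power part is a `q`-th power. [folklore] -/
theorem forall_dvd_of_mem_support_sub_deletePthPowers (q : ℕ) (P : MvPolynomial σ K) :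
    ∀ u ∈ (P - deletePthPowers q P).support, ∀ i, q ∣ u i := by
  intro u hu
  rw [MvPolynomial.mem_support_iff, coeff_sub_deletePthPowers] at hu
  by_cases h : IsPthPowerExponent q u
  · exact (isPthPowerExponent_iff q u).mp h
  · rw [if_neg h] at hu; exact absurd rfl hu

/-- The cleaning of the `q`-th-power part is `0`. [folklore] -/
theorem deletePthPowers_sub_deletePthPowers (q : ℕ) (P : MvPolynomial σ K) :
    deletePthPowers q (P - deletePthPowers q P) = 0 := by
  ext d
  rw [coeff_deletePthPowers, coeff_sub_deletePthPowers, coeff_zero]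
  split_ifs <;> rfl

/-- **A polynomial without `q`-th-power monomials is clean.** [folklore] -/
theorem deletePthPowers_eq_self_of_forall (q : ℕ) (F : MvPolynomial σ K)
    (h : ∀ d ∈ F.support, ¬ IsPthPowerExponent q d) : deletePthPowers q F = F := by
  ext d
  rw [coeff_deletePthPowers]
  by_cases hd : IsPthPowerExponent q d
  · rw [if_pos hd]
    by_cases hmem : d ∈ F.support
    · exact absurd hd (h d hmem)
    · exact (MvPolynomial.notMem_support_iff.mp hmem).symm
  · rw [if_neg hd]

/-! ## 2. Products in disjoint variables -/

/-- **Clean × clean in disjoint variables is clean**: if no variable occurs in both `P` and `Q` and neither has a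
`q`-th-power monomial, then `P * Q` has none (its monomials `u + e` keep the non-divisible coordinate of `u`). [folklore] -/
theorem deletePthPowers_mul_eq_self_of_disjoint (q : ℕ) (P Q : MvPolynomial σ K)
    (hdis : ∀ u ∈ P.support, ∀ e ∈ Q.support, ∀ i, u i = 0 ∨ e i = 0)
    (hP : ∀ u ∈ P.support, ¬ IsPthPowerExponent q u) :
    deletePthPowers q (P * Q) = P * Q := by
  refine deletePthPowers_eq_self_of_forall q _ fun d hd hpow => ?_
  obtain ⟨u, hu, e, he, rfl⟩ := Finset.mem_add.mp (support_mul P Q hd)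
  apply hP u hu
  rw [isPthPowerExponent_iff] at hpow ⊢
  intro i
  have h := hpow i
  rw [Finsupp.add_apply] at h
  rcases hdis u hu e he i with h0 | h0
  · rw [h0]; exact dvd_zero q
  · rwa [h0, add_zero] at h

/-- **THE CLEANING OF A DISJOINT PRODUCT.** If no variable occurs in both `P` and `Q`, then
`deletePthPowers q (P * Q) = P * Q − (P − deletePthPowers q P) * (Q − deletePthPowers q Q)`: the `q`-th-power part of the
product is the product of the `q`-th-power parts. [folklore] -/
theorem deletePthPowers_mul_disjoint (q : ℕ) (P Q : MvPolynomial σ K)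
    (hdis : ∀ u ∈ P.support, ∀ e ∈ Q.support, ∀ i, u i = 0 ∨ e i = 0) :
    deletePthPowers q (P * Q) =
      P * Q - (P - deletePthPowers q P) * (Q - deletePthPowers q Q) := by
  -- split both factors into `q`-th-power part and clean part
  set P₁ := P - deletePthPowers q P with hP₁
  set P₀ := deletePthPowers q P with hP₀
  set Q₁ := Q - deletePthPowers q Q with hQ₁
  set Q₀ := deletePthPowers q Q with hQ₀
  have hPdec : P = P₁ + P₀ := by rw [hP₁, sub_add_cancel]
  have hQdec : Q = Q₁ + Q₀ := by rw [hQ₁, sub_add_cancel]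
  have hP₁pow := forall_dvd_of_mem_support_sub_deletePthPowers q P
  have hQ₁pow := forall_dvd_of_mem_support_sub_deletePthPowers q Q
  -- supports of the clean parts sit inside the supports of `P`, `Q`
  have hsuppP₀ : P₀.support ⊆ P.support := fun d hd => by
    rw [MvPolynomial.mem_support_iff] at hd ⊢
    rw [hP₀, coeff_deletePthPowers] at hd
    split_ifs at hd with h
    · exact absurd rfl hd
    · exact hd
  have hsuppQ₀ : Q₀.support ⊆ Q.support := fun d hd => by
    rw [MvPolynomial.mem_support_iff] at hd ⊢
    rw [hQ₀, coeff_deletePthPowers] at hd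
    split_ifs at hd with h
    · exact absurd rfl hd
    · exact hd
  have hP₀clean : ∀ u ∈ P₀.support, ¬ IsPthPowerExponent q u := fun u hu h => by
    rw [MvPolynomial.mem_support_iff, hP₀, coeff_deletePthPowers, if_pos h] at hu
    exact hu rfl
  have hQ₀clean : ∀ u ∈ Q₀.support, ¬ IsPthPowerExponent q u := fun u hu h => by
    rw [MvPolynomial.mem_support_iff, hQ₀, coeff_deletePthPowers, if_pos h] at hu
    exact hu rfl
  -- the four products
  have h11 : deletePthPowers q (P₁ * Q₁) = 0 := by
    rw [deletePthPowers_mul_of_forall_dvd q P₁ Q₁ hP₁pow, hQ₁, deletePthPowers_sub_deletePthPowers, mul_zero]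
  have h10 : deletePthPowers q (P₁ * Q₀) = P₁ * Q₀ := by
    rw [deletePthPowers_mul_of_forall_dvd q P₁ Q₀ hP₁pow, deletePthPowers_eq_self_of_forall q Q₀ hQ₀clean]
  have h01 : deletePthPowers q (P₀ * Q₁) = P₀ * Q₁ := by
    rw [mul_comm, deletePthPowers_mul_of_forall_dvd q Q₁ P₀ hQ₁pow,
      deletePthPowers_eq_self_of_forall q P₀ hP₀clean, mul_comm]
  have h00 : deletePthPowers q (P₀ * Q₀) = P₀ * Q₀ :=
    deletePthPowers_mul_eq_self_of_disjoint q P₀ Q₀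
      (fun u hu e he => hdis u (hsuppP₀ hu) e (hsuppQ₀ he)) hP₀clean
  have hexp : P * Q = P₁ * Q₁ + (P₁ * Q₀ + P₀ * Q₁ + P₀ * Q₀) := by
    rw [hPdec, hQdec]; ring
  rw [hexp, deletePthPowers_add, deletePthPowers_add, deletePthPowers_add, h11, h10, h01, h00]
  ring

end PthPowerFactor

end Summit.ResolutionOfSingularities.ResolutionOfSingularities.Theorems.PIDim4

end
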